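import Literature.Probability.Percolation.ConditionalPositiveAssociationProofs
import HarnessLib
-- source touch 2026-08-23T23:05Z (prim-facecert gen 20): comment-only re-land to trigger a post-accept build —
-- the accept of p367252 (14:44Z) left no hub olean after the 18:18Z build-lane incident (ops-buildfix recipe, ops/buildfix/INBOX l.164);
-- no declaration changed.

/-!
# One-coordinate pivot, deletion and OR-merging of coordinates for product weights

Support file for crux `stmt-CriticalPhenomena-4575` (`NoHeavyLowerTail`), seat `prim-facecert` gen 20
(`--supports stmt-CriticalPhenomena-4575`; memo `run/shared/lean/prim/prim-l12/FROM-prim-l12-p1-g22-CHALF-ALL-GRAPHS.md` §8 and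
`prim-facecert/FINDING-gen20-*.md`).  No sorries, standard axioms.  Tools for the all-graphs proof of the sextic isolation law
`(Q6)_port` / the face inequality `(C½)`: in the finite-sum presentation of `prodBernoulli` of
`Literature/Probability/Percolation/ConditionalPositiveAssociationProofs.lean` (`BHK2006.weight w ω = ∏ (w e | 1 - w e)`,
`BHK2006.integral_prodBernoulli_eq_sum`) we record, for a finite index type `ι`:

* `weight_eq_factor_mul` — `weight w ω = c_j(ω) · weight w[j↦0] (ω ∖ {j})`;
* `sum_weight_pivot` — **one-coordinate pivot** `E_w[f] = E_{w[j↦0]}[(1 - w j)·f(ω ∖ {j}) + (w j)·f(ω ∪ {j})]`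
  (Russo/Margulis conditioning on one coordinate; it makes every cylinder probability AFFINE in each single parameter);
* `sum_weight_delete` — `E_w[f(ω ∖ {j})] = E_{w[j↦0]}[f]` (closing a coordinate = parameter `0`);
* `mem_merge_iff`, `mergeWeight_apply`, `sum_weight_merge` — **OR-merging coordinate `j` into `i`**: the image of the product law under
  `ω ↦ (ω, with i present iff i ∈ ω ∨ j ∈ ω, and j removed)` is the product law with `i ↦ 1 - (1 - w i)(1 - w j)`, `j ↦ 0`
  (two parallel edges = one edge); this is the coordinate step of the contraction of a sure pair (`…EdgeContraction`);
* `real_eq_sum_weight` — `(prodBernoulli p).real A = Σ_ω weight ω · 1_A(ω)`.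
[cite: Grimmett1999, §1.3 (product measure), §2.2 (events depending on finitely many edges)]
-/

noncomputable section

namespace Summit.CriticalPhenomena.PercolationContinuityZ3.Theorems.ProdWeightPivot

open MeasureTheory Set
open Literature.Probability.Percolation Literature.Probability.Percolation.BHK2006
open Literature.Probability.LatticeModels (prodBernoulli)
open scoped Classical

variable {ι : Type*} [Fintype ι]

/-- The weight of a configuration missing a coordinate of parameter `1` vanishes. [folklore] -/
theorem weight_eq_zero_of_not_mem {w : ι → ℝ} {j : ι} (hj : w j = 1) {ω : Set ι} (hω : j ∉ ω) :
    weight w ω = 0 := by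
  unfold weight
  exact Finset.prod_eq_zero (Finset.mem_univ j) (by simp [hω, hj])

/-- Weighted sums only see configurations of nonzero weight. [folklore] -/
theorem sum_weight_congr {w : ι → ℝ} {f g : Set ι → ℝ} (h : ∀ ω, weight w ω ≠ 0 → f ω = g ω) :
    ∑ ω, weight w ω * f ω = ∑ ω, weight w ω * g ω := by
  refine Finset.sum_congr rfl fun ω _ => ?_
  by_cases h0 : weight w ω = 0
  · rw [h0, zero_mul, zero_mul]
  · rw [h ω h0]

/-- One-coordinate factorisation of the product weight: `weight w ω = c_j(ω) · weight w[j↦0] (ω ∖ {j})`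
with `c_j(ω) = w j` if `j ∈ ω` and `1 - w j` otherwise. [folklore] -/
theorem weight_eq_factor_mul (w : ι → ℝ) (j : ι) (ω : Set ι) :
    weight w ω = (if j ∈ ω then w j else 1 - w j) * weight (Function.update w j 0) (ω \ {j}) := by
  unfold weight
  rw [← Finset.mul_prod_erase Finset.univ _ (Finset.mem_univ j)]
  conv_rhs => rw [← Finset.mul_prod_erase Finset.univ _ (Finset.mem_univ j)]
  have hj : j ∉ ω \ {j} := by simp
  simp only [hj, if_false, Function.update_self, sub_zero, one_mul]
  congr 1
  refine Finset.prod_congr rfl fun e he => ?_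
  have hej : e ≠ j := Finset.ne_of_mem_erase he
  have hmem : e ∈ ω \ {j} ↔ e ∈ ω := by simp [hej]
  simp only [hmem, Function.update_of_ne hej]

/-- **One-coordinate pivot.** `E_w[f] = E_{w[j↦0]}[(1 - w j)·f(ω ∖ {j}) + (w j)·f(ω ∪ {j})]`. [folklore] -/
theorem sum_weight_pivot (w : ι → ℝ) (j : ι) (f : Set ι → ℝ) :
    ∑ ω, weight w ω * f ω =
      ∑ ω, weight (Function.update w j 0) ω * ((1 - w j) * f (ω \ {j}) + w j * f (insert j ω)) := by
  set w₀ := Function.update w j 0 with hw₀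
  set R : Set ι → ℝ := fun ω => weight w₀ (ω \ {j}) with hR
  -- pointwise decompositions
  have hL : ∀ ω, weight w ω * f ω =
      (if j ∈ ω then 0 else (1 - w j) * R ω * f (ω \ {j})) + (if j ∈ ω then w j * R ω * f ω else 0) := by
    intro ω
    rw [weight_eq_factor_mul w j ω]
    by_cases hj : j ∈ ω
    · simp [hj, hR, hw₀]
    · have : ω \ {j} = ω := by simp [hj]
      simp [hj, hR, hw₀, this]
  have hRt : ∀ ω, weight w₀ ω * ((1 - w j) * f (ω \ {j}) + w j * f (insert j ω)) =
      (if j ∈ ω then 0 else (1 - w j) * R ω * f (ω \ {j})) + (if j ∈ ω then 0 else w j * R ω * f (insert j ω)) := by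
    intro ω
    by_cases hj : j ∈ ω
    · have h0 : weight w₀ ω = 0 := Finset.prod_eq_zero (Finset.mem_univ j) (by simp [hj, hw₀])
      simp [hj, h0]
    · have : ω \ {j} = ω := by simp [hj]
      simp [hj, hR, this]; ring
  simp_rw [hL, hRt, Finset.sum_add_distrib]
  congr 1
  -- reindex the second sum by the involution `ω ↦ ω ∆ {j}`
  have hinv : Function.Involutive (fun ω : Set ι => symmDiff ω {j}) := fun ω => by
    ext e; by_cases h : e = j <;> by_cases he : e ∈ ω <;> simp [h, he]
  refine (Fintype.sum_bijective _ hinv.bijective _ _ fun ω => ?_).symm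
  by_cases hj : j ∈ ω
  · have h1 : symmDiff ω {j} = ω \ {j} := by ext e; by_cases h : e = j <;> simp [Set.mem_symmDiff, h, hj]
    have h3 : insert j (ω \ {j}) = ω := by ext e; by_cases h : e = j <;> simp [h, hj]
    have h4 : R (ω \ {j}) = R ω := by simp [hR]
    simp only [h1, h4]
    simp [hj]
  · have h1 : symmDiff ω {j} = insert j ω := by ext e; by_cases h : e = j <;> simp [Set.mem_symmDiff, h, hj]
    have h3 : R (insert j ω) = R ω := by
      have : insert j ω \ {j} = ω \ {j} := by ext e; by_cases h : e = j <;> simp [h]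
      simp only [hR, this]
    simp only [h1, h3]
    simp [hj]

/-- **Deleting a coordinate**: `E_w[f(ω ∖ {j})] = E_{w[j↦0]}[f]`. [folklore] -/
theorem sum_weight_delete (w : ι → ℝ) (j : ι) (f : Set ι → ℝ) :
    ∑ ω, weight w ω * f (ω \ {j}) = ∑ ω, weight (Function.update w j 0) ω * f ω := by
  rw [sum_weight_pivot w j (fun ω => f (ω \ {j}))]
  refine sum_weight_congr fun ω hω => ?_
  have hj : j ∉ ω := fun h => hω (Finset.prod_eq_zero (Finset.mem_univ j) (by simp [h]))
  have h1 : (ω \ {j}) \ {j} = ω := by ext e; by_cases h : e = j <;> simp [h, hj]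
  have h2 : insert j ω \ {j} = ω := by ext e; by_cases h : e = j <;> simp [h, hj]
  simp only [h1, h2]; ring

omit [Fintype ι] in
/-- Membership in the OR-merged configuration `merge_{i←j}(ω) = (if j ∈ ω then ω ∪ {i} else ω) ∖ {j}`. [folklore] -/
theorem mem_merge_iff {i j : ι} (hij : i ≠ j) (ω : Set ι) (k : ι) :
    k ∈ (if j ∈ ω then insert i ω else ω) \ {j} ↔ (k ∈ ω ∧ k ≠ j) ∨ (k = i ∧ j ∈ ω) := by
  by_cases hj : j ∈ ω
  · by_cases hki : k = i
    · subst hki; simp [hj, hij]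
    · simp [hj, hki]
  · simp only [hj, if_false, Set.mem_sdiff, Set.mem_singleton_iff, and_false, or_false]

omit [Fintype ι] in
/-- Values of the OR-merged parameters `w[j↦0][i ↦ 1-(1-w i)(1-w j)]`. [folklore] -/
theorem mergeWeight_apply {w : ι → ℝ} {i j : ι} (hij : i ≠ j) (k : ι) :
    Function.update (Function.update w j 0) i (1 - (1 - w i) * (1 - w j)) k =
      if k = i then 1 - (1 - w i) * (1 - w j) else if k = j then 0 else w k := by
  by_cases hki : k = i
  · subst hki; simp
  · rw [if_neg hki, Function.update_of_ne hki]
    by_cases hkj : k = j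
    · subst hkj; simp
    · rw [if_neg hkj, Function.update_of_ne hkj]

/-- **Merging two coordinates by OR**: `E_w[f(merge_{i←j} ω)] = E_{w[j↦0][i↦1-(1-w i)(1-w j)]}[f]`, `merge_{i←j}(ω) = (if j ∈ ω then ω ∪ {i} else ω) ∖ {j}`. [folklore] -/
theorem sum_weight_merge (w : ι → ℝ) {i j : ι} (hij : i ≠ j) (f : Set ι → ℝ) :
    ∑ ω, weight w ω * f ((if j ∈ ω then insert i ω else ω) \ {j}) =
      ∑ ω, weight (Function.update (Function.update w j 0) i (1 - (1 - w i) * (1 - w j))) ω * f ω := by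
  set merge : Set ι → Set ι := fun ω => (if j ∈ ω then insert i ω else ω) \ {j} with hmerge
  set W := Function.update (Function.update w j 0) i (1 - (1 - w i) * (1 - w j)) with hW
  -- pivot the left side on `j`
  rw [sum_weight_pivot w j (fun ω => f (merge ω))]
  have step1 : ∑ ω, weight (Function.update w j 0) ω *
      ((1 - w j) * f (merge (ω \ {j})) + w j * f (merge (insert j ω))) =
      ∑ ω, weight (Function.update w j 0) ω * ((1 - w j) * f ω + w j * f (insert i ω)) := by
    refine sum_weight_congr fun ω hω => ?_
    have hj : j ∉ ω := fun h => hω (Finset.prod_eq_zero (Finset.mem_univ j) (by simp [h]))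
    have h1 : merge (ω \ {j}) = ω := by
      ext k; rw [hmerge, mem_merge_iff hij]; by_cases hk : k = j <;> simp [hk, hj]
    have h2 : merge (insert j ω) = insert i ω := by
      ext k; rw [hmerge, mem_merge_iff hij]
      by_cases hk : k = j <;> by_cases hki : k = i <;> simp [hk, hki, hj, hij, hij.symm]
    rw [h1, h2]
  rw [step1]
  -- pivot both sides on `i`
  rw [sum_weight_pivot (Function.update w j 0) i, sum_weight_pivot W i]
  have hW0 : Function.update W i 0 = Function.update (Function.update w j 0) i 0 := by
    rw [hW, Function.update_idem]
  have hWi : W i = 1 - (1 - w i) * (1 - w j) := by rw [hW, mergeWeight_apply hij]; simp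
  have hwi : Function.update w j 0 i = w i := Function.update_of_ne hij _ _
  rw [hW0, hWi, hwi]
  refine Finset.sum_congr rfl fun ω _ => ?_
  have h1 : insert i (ω \ {i}) = insert i ω := by ext k; by_cases hk : k = i <;> simp [hk]
  have h2 : insert i (insert i ω) = insert i ω := Set.insert_idem i ω
  rw [h1, h2]; ring

/-- The `prodBernoulli` probability of an event on a finite index type as a weighted sum of its indicator. [folklore] -/
theorem real_eq_sum_weight (p : ι → unitInterval) {A : Set (Set ι)} (hA : MeasurableSet A) :
    (prodBernoulli p).real A = ∑ ω, weight (fun e => (p e : ℝ)) ω * (if ω ∈ A then 1 else 0) := by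
  rw [← integral_indicator_one hA, integral_prodBernoulli_eq_sum]
  refine Finset.sum_congr rfl fun ω _ => ?_
  by_cases h : ω ∈ A <;> simp [h]

end Summit.CriticalPhenomena.PercolationContinuityZ3.Theorems.ProdWeightPivot
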